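import Literature.IUT.LogVolume.ExplicitEstimatesSzpiroLocalBoundPlacesProofs
import Literature.IUT.LogVolume.ExplicitEstimatesTheorem53FromCor52
import HarnessLib

/-!
# [ExpEst] Remark 5.3.3: the classical input (R1), PROVED for every number field

[ExpEst] = Mochizuki–Fesenko–Hoshi–Minamide–Porowski, *Explicit estimates in inter-universal Teichmüller
theory*, Kodai Math. J. 45 (2022), Remark 5.3.3 (p. 222). The remark recalls, for a number field `L` of degree
`d`, `λ ∈ L ∖ {0, 1}`, the Legendre curve `E_λ : y² = x(x−1)(x−λ)`, its minimal discriminant `𝔇_{E_λ}` and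
conductor `𝔣_{E_λ}` (ideals of `𝓞 L`), the classical comparison

  (R1) `log N_{L/ℚ}(𝔇_{E_λ}) ≤ d·h_non(j(E_λ)) + 6·(log N_{L/ℚ}(𝔣_{E_λ}) − log rad_L(λ, 1−λ, −1)) + d·(8 − (−4))·log 2`

("by applying a similar argument to the argument applied in [Silv1], Chapter VII, §5, the proof of Proposition
5.4", p. 222 l. 34–37), typed in the tree as the predicate `ExpEst.Rmk533LocalBound λ`
(`ExplicitEstimatesSzpiroConductorForm`, where it is a HYPOTHESIS of `log_minDisc_le_of_thm53i`; likewise of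
`legendreMinDiscNorm_le_of_thm53i` in `…ConductorFormRadicalBoundProofs`).

This PROOF-ONLY file proves (R1): `rmk533LocalBound_of_ne : λ ≠ 0 → λ ≠ 1 → Rmk533LocalBound λ`, for every
number field `L`. It is the sum over the finite places `v` of `L`, weighted by `log N(v) > 0`, of the per-place
inequality `rmk533_local` of `…LocalBoundPlacesProofs`

  `ord_v(𝔇_{E_λ}) + 6·[v ∈ I_L(λ,1−λ,−1)] ≤ (−ord_v j(λ))⁺ + 6·f_v(E_λ) + 12·ord_v(2)`,

using the five bookkeeping identities (all sums over one finite set `S` of places containing every support):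
`log N(𝔇) = Σ_v ord_v(𝔇)·log N(v)` and `log N(𝔣) = Σ_v f_v·log N(v)` (`𝔇 = ∏ 𝔭_v^{ord_v 𝔇}`, `𝔣 = ∏ 𝔭_v^{f_v}`,
multiplicativity of `Ideal.absNorm`), `log rad_L = Σ_{v ∈ I_L} log N(v)` (`radL_eq_radicalNorm`),
`d·h_non(j) = Σ_v (−ord_v j)⁺·log N(v)` ([ExpEst] Def 1.1 (i) at a finite place, tree `posLog_finitePlace_mk`,
Rmk 1.10.1), and `d·log 2 = log N((2)) = Σ_v ord_v(2)·log N(v)` (`(2) = ∏ 𝔭_v^{ord_v 2}`, `N((2)) = 2^d`).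

Consequence recorded here: the corrected product line of Remark 5.3.3 (`legendreMinDiscNorm_le_of_thm53i`) and
the Szpiro shape on the Legendre family now depend on Theorem 5.3 (i) ALONE (`legendreMinDiscNorm_le_of_thm53i'`,
`szpiroShape_legendre_of_thm53i'`); §4 threads the discharge through the remaining conditional theorems of
`ExplicitEstimatesSzpiroConductorForm` (`log_minDisc_le_of_thm53i'`, `rmk533Product_of_thm53i'`,
`rmk533Product_of_thm53i_of_not_hasGoodReductionAt_above_two` — the PRINTED line with the printed constant `2^{12d}`
under the proviso missing in print —, `rmk533_of_thm53i_of_rad_eq'`). Nothing in this file is disputed material: (R1) is classical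
(Silverman AEC VII.5, VIII.8; ATAEC IV.10); Theorem 5.3 (i) enters only as an explicit hypothesis.

PROOF-ONLY: no `def`, no `instance`, no notation, no new fact. No side is taken on [IUTchIII] Cor. 3.12 or on any
author; typed ≠ proved ≠ endorsed; no abc / Szpiro claim is made.
-/

open scoped Classical
open NumberField IsDedekindDomain WeierstrassCurve
open Literature.NumberTheory.DiophantineGeometry Literature.NumberTheory.EllipticCurves

namespace Literature.IUT.LogVolume

namespace ExpEst

open Real Cor22

variable {L : Type*} [Field L] [NumberField L]

/-! ## 1. Bookkeeping: global quantities as sums over a finite set of places -/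

/-- `log N(∏ᶠ_v 𝔭_v^{e_v}) = Σ_{v ∈ S} e_v·log N(v)` whenever the support of `e` lies in the finite set `S`
(multiplicativity of the absolute norm). [folklore] -/
private theorem log_absNorm_finprod_pow (e : HeightOneSpectrum (𝓞 L) → ℕ)
    (S : Finset (HeightOneSpectrum (𝓞 L))) (hS : ∀ v, e v ≠ 0 → v ∈ S) :
    Real.log ((Ideal.absNorm (∏ᶠ v : HeightOneSpectrum (𝓞 L), v.asIdeal ^ e v) : ℕ) : ℝ) =
      ∑ v ∈ S, (e v : ℝ) * logNorm L v := by
  have hsub : (Function.mulSupport fun v : HeightOneSpectrum (𝓞 L) => v.asIdeal ^ e v) ⊆ S := by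
    intro v hv
    rw [Function.mem_mulSupport] at hv
    exact Finset.mem_coe.mpr (hS v fun h => hv (by rw [h, pow_zero]))
  have hne : ∀ v ∈ S, ((Ideal.absNorm (v.asIdeal ^ e v) : ℕ) : ℝ) ≠ 0 := by
    intro v _
    rw [map_pow, Nat.cast_pow]
    exact pow_ne_zero _ (by exact_mod_cast (Ideal.absNorm_eq_zero_iff.not.mpr v.ne_bot))
  rw [finprod_eq_prod_of_mulSupport_subset _ hsub, map_prod, Nat.cast_prod, Real.log_prod hne]
  refine Finset.sum_congr rfl fun v _ => ?_
  rw [map_pow, Nat.cast_pow, Real.log_pow, logNorm]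

/-- `ord_v(2)` is the exponent of `𝔭_v` in the factorisation of the ideal `(2)` of `𝓞 L`. [folklore] -/
private theorem ord_two_eq_count (v : HeightOneSpectrum (𝓞 L)) :
    ord L v (2 : L) = ((Associates.mk v.asIdeal).count
      (Associates.mk (Ideal.span {(2 : 𝓞 L)})).factors : ℤ) := by
  rw [ord, show (2 : L) = algebraMap (𝓞 L) L 2 from (map_ofNat _ 2).symm,
    HeightOneSpectrum.valuation_of_algebraMap, HeightOneSpectrum.intValuation_if_neg _ two_ne_zero,
    WithZero.log_exp, neg_neg]

/-- `ord_v(2) ≥ 0`. [folklore] -/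
private theorem ord_two_nonneg' (v : HeightOneSpectrum (𝓞 L)) : 0 ≤ ord L v (2 : L) := by
  have h := ord_nonneg_of_isIntegral L v 2
  rwa [show ((2 : 𝓞 L) : L) = 2 from map_ofNat (algebraMap (𝓞 L) L) 2] at h

/-- `(2) = ∏ᶠ_v 𝔭_v^{ord_v 2}` in `𝓞 L` (Dedekind factorisation, Mathlib
`Ideal.finprod_heightOneSpectrum_factorization`). [folklore] -/
private theorem finprod_pow_ord_two :
    ∏ᶠ v : HeightOneSpectrum (𝓞 L), v.asIdeal ^ (ord L v (2 : L)).toNat = Ideal.span {(2 : 𝓞 L)} := by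
  have h2 : Ideal.span {(2 : 𝓞 L)} ≠ 0 := by
    rw [Ne, Ideal.zero_eq_bot, Ideal.span_singleton_eq_bot]
    exact two_ne_zero
  conv_rhs => rw [← Ideal.finprod_heightOneSpectrum_factorization h2]
  refine finprod_congr fun v => ?_
  rw [IsDedekindDomain.HeightOneSpectrum.maxPowDividing, ord_two_eq_count, Int.toNat_natCast]

/-- `N_{L/ℚ}((2)) = 2^{[L:ℚ]}`. [folklore] -/
private theorem absNorm_span_two' : Ideal.absNorm (Ideal.span {(2 : 𝓞 L)}) = 2 ^ Module.finrank ℚ L := by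
  rw [show (2 : 𝓞 L) = ((2 : ℕ) : 𝓞 L) by norm_num, Ideal.absNorm_span_natCast, RingOfIntegers.rank]

/-- `Σ_{v ∈ S} ord_v(2)·log N(v) = [L:ℚ]·log 2` for every finite set of places `S` containing the places above
`2` (take `log N(·)` of `(2) = ∏ 𝔭_v^{ord_v 2}`, `N((2)) = 2^{[L:ℚ]}`). This is the source of the printed term
`d·(8 − (−4))·log 2` of (R1). [folklore] -/
private theorem sum_ord_two_mul_logNorm (S : Finset (HeightOneSpectrum (𝓞 L)))
    (hS : ∀ v, ord L v (2 : L) ≠ 0 → v ∈ S) :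
    ∑ v ∈ S, (ord L v (2 : L) : ℝ) * logNorm L v = (Module.finrank ℚ L : ℝ) * Real.log 2 := by
  have h := log_absNorm_finprod_pow (fun v => (ord L v (2 : L)).toNat) S
    (fun v hv => hS v fun h => hv (by rw [h]; rfl))
  rw [finprod_pow_ord_two, absNorm_span_two', Nat.cast_pow, Real.log_pow] at h
  push_cast at h
  rw [h]
  refine Finset.sum_congr rfl fun v _ => ?_
  congr 1
  exact_mod_cast (Int.toNat_of_nonneg (ord_two_nonneg' v)).symm

/-- The places above `2` form a finite set: `ord_v(2) ≠ 0` forces `‖2⁻¹‖_v > 1`, i.e. `v` lies in the (finite,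
Mathlib `HeightOneSpectrum.Support.finite`) support of `2⁻¹`. [folklore] -/
private theorem finite_setOf_ord_two_ne_zero :
    {v : HeightOneSpectrum (𝓞 L) | ord L v (2 : L) ≠ 0}.Finite := by
  refine (HeightOneSpectrum.Support.finite (𝓞 L) ((2 : L)⁻¹)).subset fun v hv => ?_
  rw [Set.mem_setOf_eq] at hv
  have h0 : 0 < ord L v (2 : L) := lt_of_le_of_ne (ord_two_nonneg' v) (Ne.symm hv)
  have hv2 : v.valuation L (2 : L) ≠ 0 := (v.valuation L).ne_zero_iff.mpr two_ne_zero
  have hlt : v.valuation L (2 : L) < 1 := by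
    rw [← WithZero.exp_zero, ← WithZero.log_lt_iff_lt_exp hv2]
    unfold ord at h0
    omega
  show 1 < v.valuation L (2 : L)⁻¹
  rw [map_inv₀, one_lt_inv_iff₀]
  exact ⟨zero_lt_iff.mpr hv2, hlt⟩

/-- `d·h_non(x) = Σ_{v ∈ S} (−ord_v x)⁺·log N(v)` for every finite set of places `S` containing the poles of `x`:
[ExpEst] Def 1.1 (i) summed over the finite places (tree `posLog_finitePlace_mk` = Rmk 1.10.1 per place).
[folklore] -/
private theorem finrank_mul_hNon_eq (x : L) (S : Finset (HeightOneSpectrum (𝓞 L)))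
    (hS : ∀ v, ord L v x < 0 → v ∈ S) :
    (Module.finrank ℚ L : ℝ) * hNon x = ∑ v ∈ S, ((-ord L v x).toNat : ℝ) * logNorm L v := by
  unfold hNon
  rw [← mul_assoc, mul_inv_cancel₀ (by exact_mod_cast Module.finrank_pos.ne'), one_mul,
    ← finsum_comp_equiv FinitePlace.equivHeightOneSpectrum.symm]
  have key : ∀ v : HeightOneSpectrum (𝓞 L),
      log⁺ ((FinitePlace.equivHeightOneSpectrum.symm v) x) = ((-ord L v x).toNat : ℝ) * logNorm L v := by
    intro v
    by_cases hx : x = 0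
    · subst hx
      simp [ord_zero]
    · exact posLog_finitePlace_mk v hx
  rw [finsum_congr key, finsum_eq_sum_of_support_subset _ (s := S) ?_]
  intro v hv
  rw [Function.mem_support] at hv
  by_contra h
  apply hv
  have : ¬ ord L v x < 0 := fun h' => h (hS v h')
  rw [Int.toNat_of_nonpos (by omega)]
  simp

/-- The poles of `x` form a finite set (`ord_v x < 0` iff `v` lies in the support of `x`,
Mathlib `HeightOneSpectrum.Support.finite`). [folklore] -/
private theorem finite_setOf_ord_neg (x : L) : {v : HeightOneSpectrum (𝓞 L) | ord L v x < 0}.Finite := by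
  refine (HeightOneSpectrum.Support.finite (𝓞 L) x).subset fun v hv => ?_
  rw [Set.mem_setOf_eq] at hv
  by_cases hx : x = 0
  · subst hx
    simp [ord_zero] at hv
  have hvx : v.valuation L x ≠ 0 := (v.valuation L).ne_zero_iff.mpr hx
  show 1 < v.valuation L x
  rw [← WithZero.exp_zero, ← WithZero.lt_log_iff_exp_lt hvx]
  unfold ord at hv
  omega

/-- `log rad_L(a,b,c) = Σ_{v ∈ S} [v ∈ I_L(a,b,c)]·log N(v)` for every finite set of places `S ⊇ I_L(a,b,c)`
(`radL_eq_radicalNorm`: `rad_L = ∏_{v ∈ I_L} N(v)`). [folklore] -/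
private theorem log_radL_eq_sum (a b c : L) (hfin : (badPrimes a b c).Finite)
    (S : Finset (HeightOneSpectrum (𝓞 L))) (hS : hfin.toFinset ⊆ S) :
    Real.log (radL a b c : ℝ) =
      ∑ v ∈ S, (if v ∈ badPrimes a b c then (1 : ℝ) else 0) * logNorm L v := by
  rw [radL_eq_radicalNorm]
  unfold radicalNorm
  rw [finprod_mem_eq_finite_toFinset_prod _ hfin, Nat.cast_prod,
    Real.log_prod (fun v _ => by exact_mod_cast (Ideal.absNorm_eq_zero_iff.not.mpr v.ne_bot))]
  rw [← Finset.sum_subset hS (fun v _ hv => by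
    rw [if_neg (by simpa [Set.Finite.mem_toFinset] using hv), zero_mul])]
  exact Finset.sum_congr rfl fun v hv => by
    rw [if_pos (by simpa [Set.Finite.mem_toFinset] using hv), one_mul, logNorm]

/-! ## 2. (R1) proved -/

/-- **[ExpEst] Remark 5.3.3, the classical input (R1), PROVED for every number field** (p. 222 l. 34–37: "by
applying a similar argument to the argument applied in [Silv1], Chapter VII, §5, the proof of Proposition 5.4, we
obtain that `log(N_{L/ℚ}(𝔇_{E_λ})) ≤ d·h_non(j(E_λ)) + 6(log(N_{L/ℚ}(𝔣_{E_λ})) − log(rad_L(a,b,c))) + d·(8 −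
(−4)) log 2`", `(a,b,c) = (λ, 1−λ, −1)`): for every number field `L` and every `λ ∈ L`, `λ ≠ 0, 1`,
`Rmk533LocalBound λ` holds. Proof: the per-place inequality `rmk533_local` (`…LocalBoundPlacesProofs`, the
printed `w`-scaling argument at every finite place), multiplied by `log N(v) > 0` and summed over a finite set of
places containing the bad places of `E_λ`, `I_L(λ,1−λ,−1)`, the poles of `j(λ)` and the places above `2`; the
five sums are identified by §1. CLASSICAL (no Θ-data; nothing disputed is used).
[cite: MochizukiEtAl2022, Rmk 5.3.3 p. 222 l. 34–37] -/
theorem rmk533LocalBound_of_ne {lam : L} (h0 : lam ≠ 0) (h1 : lam ≠ 1) : Rmk533LocalBound lam := by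
  haveI := isElliptic_legendre_of_ne h0 h1
  have hl1 : (1 : L) - lam ≠ 0 := sub_ne_zero.mpr (Ne.symm h1)
  have hfinI := Gyory2008.badPrimes_finite h0 hl1 (neg_ne_zero.mpr (one_ne_zero' L))
  have hfinD : {v : HeightOneSpectrum (𝓞 L) |
      (⟨0, -(1 + lam), 0, lam, 0⟩ : WeierstrassCurve L).ordMinimalDiscriminant v ≠ 0}.Finite :=
    finite_setOf_ordMinimalDiscriminant_ne_zero_holds (A := 𝓞 L) _
  have hfinJ := finite_setOf_ord_neg (Cor22.jInv lam)
  have hfin2 := finite_setOf_ord_two_ne_zero (L := L)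
  obtain ⟨S, hSD, hSI, hSJ, hS2⟩ : ∃ S : Finset (HeightOneSpectrum (𝓞 L)),
      (∀ v, (⟨0, -(1 + lam), 0, lam, 0⟩ : WeierstrassCurve L).ordMinimalDiscriminant v ≠ 0 → v ∈ S) ∧
        hfinI.toFinset ⊆ S ∧ (∀ v, ord L v (Cor22.jInv lam) < 0 → v ∈ S) ∧
          (∀ v, ord L v (2 : L) ≠ 0 → v ∈ S) :=
    ⟨hfinD.toFinset ∪ hfinI.toFinset ∪ hfinJ.toFinset ∪ hfin2.toFinset,
      fun v hv => Finset.mem_union_left _ (Finset.mem_union_left _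
        (Finset.mem_union_left _ (hfinD.mem_toFinset.mpr hv))),
      fun v hv => Finset.mem_union_left _ (Finset.mem_union_left _ (Finset.mem_union_right _ hv)),
      fun v hv => Finset.mem_union_left _ (Finset.mem_union_right _ (hfinJ.mem_toFinset.mpr hv)),
      fun v hv => Finset.mem_union_right _ (hfin2.mem_toFinset.mpr hv)⟩
  have hSF : ∀ v, (⟨0, -(1 + lam), 0, lam, 0⟩ : WeierstrassCurve L).conductorExponent v ≠ 0 → v ∈ S :=
    fun v hv => hSD v fun h => hv (Nat.eq_zero_of_le_zero
      (h ▸ WeierstrassCurve.conductorExponent_le_ordMinimalDiscriminant v _))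
  -- the five identities
  have eD : Real.log (legendreMinDiscNorm lam : ℝ) = ∑ v ∈ S,
      ((⟨0, -(1 + lam), 0, lam, 0⟩ : WeierstrassCurve L).ordMinimalDiscriminant v : ℝ) * logNorm L v := by
    rw [legendreMinDiscNorm_def, WeierstrassCurve.minimalDiscriminantNorm,
      WeierstrassCurve.minimalDiscriminantIdeal]
    exact log_absNorm_finprod_pow _ S hSD
  have eF : Real.log (legendreCondNorm lam : ℝ) = ∑ v ∈ S,
      ((⟨0, -(1 + lam), 0, lam, 0⟩ : WeierstrassCurve L).conductorExponent v : ℝ) * logNorm L v := by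
    rw [legendreCondNorm_def, WeierstrassCurve.conductorNorm, WeierstrassCurve.conductor]
    exact log_absNorm_finprod_pow _ S hSF
  have eR := log_radL_eq_sum lam (1 - lam) (-1) hfinI S hSI
  have eH := finrank_mul_hNon_eq (Cor22.jInv lam) S hSJ
  have e2 := sum_ord_two_mul_logNorm S hS2
  -- the local inequality, weighted by `log N(v) > 0`
  have hloc : ∀ v ∈ S,
      (((⟨0, -(1 + lam), 0, lam, 0⟩ : WeierstrassCurve L).ordMinimalDiscriminant v : ℝ) +
          6 * (if v ∈ badPrimes lam (1 - lam) (-1) then (1 : ℝ) else 0)) * logNorm L v ≤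
        (((-ord L v (Cor22.jInv lam)).toNat : ℝ) +
          6 * ((⟨0, -(1 + lam), 0, lam, 0⟩ : WeierstrassCurve L).conductorExponent v : ℝ) +
            12 * (ord L v (2 : L) : ℝ)) * logNorm L v := by
    intro v _
    refine mul_le_mul_of_nonneg_right ?_ (logNorm_pos L v).le
    have h := rmk533_local v h0 h1
    have hmax : (((-ord L v (Cor22.jInv lam)).toNat : ℤ) : ℝ) = ((max 0 (-ord L v (Cor22.jInv lam)) : ℤ) : ℝ) := by
      rw [Int.toNat_eq_max, max_comm]
    have hcast : (((-ord L v (Cor22.jInv lam)).toNat : ℕ) : ℝ) = (((-ord L v (Cor22.jInv lam)).toNat : ℤ) : ℝ) :=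
      (Int.cast_natCast _).symm
    rw [hcast, hmax]
    split_ifs with hI
    · rw [if_pos hI] at h
      exact_mod_cast h
    · rw [if_neg hI] at h
      exact_mod_cast h
  have hsum := Finset.sum_le_sum hloc
  simp only [add_mul, Finset.sum_add_distrib, mul_assoc, ← Finset.mul_sum] at hsum
  unfold Rmk533LocalBound
  rw [eD, eH, eF, eR]
  have h12 : (Module.finrank ℚ L : ℝ) * (8 - (-4)) * Real.log 2 =
      12 * ∑ v ∈ S, (ord L v (2 : L) : ℝ) * logNorm L v := by
    rw [e2]; ring
  rw [h12]
  linarith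

/-! ## 3. Consequences: the product line and the Szpiro shape from Theorem 5.3 (i) alone -/

/-- **[ExpEst] Remark 5.3.3, the product line, conditional on Theorem 5.3 (i) ALONE** (p. 222 l. 43–45, as
re-derived in `…ConductorFormRadicalBoundProofs` on the corrected input (R0′) with the constant `2^{(12+6ε)d}`):
for `L` mono-complex, `λ ≠ 0, 1`, `0 < ε ≤ 1`, Theorem 5.3 (i) implies `N(𝔇_{E_λ}) ≤ 2^{(12+6ε)d}·Δ_L^{6(1+ε)}·
exp(d·h_d(ε))·N(𝔣_{E_λ})^{6(1+ε)}` — the hypothesis (R1) of `legendreMinDiscNorm_le_of_thm53i` being now the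
theorem `rmk533LocalBound_of_ne`. CONDITIONAL on `Thm53i` (whose only known derivation is the DISPUTED
[IUTchIII] Cor. 3.12); no side taken. [cite: MochizukiEtAl2022, Rmk 5.3.3 p. 222 l. 43–45] -/
theorem legendreMinDiscNorm_le_of_thm53i' {lam : L} {ε : ℝ} (h53 : Thm53i L lam (1 - lam) (-1) ε)
    (hL : IsMonoComplex L) (h0 : lam ≠ 0) (h1 : lam ≠ 1) (hε : 0 < ε) (hε1 : ε ≤ 1) :
    (legendreMinDiscNorm lam : ℝ) ≤
      (2 : ℝ) ^ ((12 + 6 * ε) * (Module.finrank ℚ L : ℝ)) * (absDisc L : ℝ) ^ (6 * (1 + ε)) *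
        Real.exp ((Module.finrank ℚ L : ℝ) * hd (Module.finrank ℚ L) ε) *
          (legendreCondNorm lam : ℝ) ^ (6 * (1 + ε)) :=
  legendreMinDiscNorm_le_of_thm53i (rmk533LocalBound_of_ne h0 h1) h53 hL h0 h1 hε hε1

/-- **The Szpiro shape on the Legendre family from Theorem 5.3 (i) ALONE** (the reading of Remark 5.3.3, p. 222
l. 45–48: "a sharper version of Szpiro's conjecture in the case of elliptic curves defined by the Legendre form"):
for `L` mono-complex, Theorem 5.3 (i) for all `(λ, ε)` gives, for every `ε' > 0`, a constant `C = C(L, ε')` with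
`N(𝔇_{E_λ}) ≤ C·N(𝔣_{E_λ})^{6+ε'}` for all `λ ∈ L ∖ {0,1}` — `szpiroShape_legendre_of_thm53i` with its hypothesis
(R1) discharged by `rmk533LocalBound_of_ne`. CONDITIONAL on `Thm53i` (DISPUTED derivation); no Szpiro / abc
claim is made; no side taken. [cite: MochizukiEtAl2022, Rmk 5.3.3 p. 222 l. 45–48] -/
theorem szpiroShape_legendre_of_thm53i' (hL : IsMonoComplex L)
    (h53 : ∀ (lam : L) (ε : ℝ), Thm53i L lam (1 - lam) (-1) ε) :
    ∀ ε' : ℝ, 0 < ε' → ∃ C : ℝ, ∀ lam : L, lam ≠ 0 → lam ≠ 1 →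
      (((⟨0, -(1 + lam), 0, lam, 0⟩ : WeierstrassCurve L).minimalDiscriminantNorm (𝓞 L) : ℕ) : ℝ) ≤
        C * (((⟨0, -(1 + lam), 0, lam, 0⟩ : WeierstrassCurve L).conductorNorm (𝓞 L) : ℕ) : ℝ) ^ (6 + ε') :=
  szpiroShape_legendre_of_thm53i hL (fun _ h0 h1 => rmk533LocalBound_of_ne h0 h1) h53

/-! ## 4. The discharge of (R1) threaded through the printed derivation -/

/-- **The first step of the printed derivation, from Theorem 5.3 (i) ALONE** — `log_minDisc_le_of_thm53i` of
`ExplicitEstimatesSzpiroConductorForm` with its hypothesis (R1) discharged by `rmk533LocalBound_of_ne`: for `L`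
mono-complex, `λ ≠ 0, 1`, `0 < ε ≤ 1`, Theorem 5.3 (i) at `(λ, 1−λ, −1; ε)` gives `log N(𝔇_{E_λ}) ≤ 12d·log 2 +
max{6(1+ε)·log(Δ_L·rad_L), d·h_d(ε)} + 6·(log N(𝔣_{E_λ}) − log rad_L)`. CONDITIONAL on `Thm53i` (CANDIDATE; disputed
derivation); no side taken. [cite: MochizukiEtAl2022, Rmk 5.3.3 p. 222 l. 34–45] -/
theorem log_minDisc_le_of_thm53i' {lam : L} {ε : ℝ} (hL : IsMonoComplex L) (h0 : lam ≠ 0) (h1 : lam ≠ 1)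
    (hε : 0 < ε) (hε1 : ε ≤ 1) (h53 : Thm53i L lam (1 - lam) (-1) ε) :
    Real.log (legendreMinDiscNorm lam : ℝ) ≤
      12 * (Module.finrank ℚ L : ℝ) * Real.log 2 +
        max (6 * (1 + ε) * Real.log ((absDisc L : ℝ) * (radL lam (1 - lam) (-1) : ℝ)))
            ((Module.finrank ℚ L : ℝ) * hd (Module.finrank ℚ L) ε) +
        6 * (Real.log (legendreCondNorm lam : ℝ) - Real.log (radL lam (1 - lam) (-1) : ℝ)) :=
  log_minDisc_le_of_thm53i hL h0 h1 hε hε1 (rmk533LocalBound_of_ne h0 h1) h53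

/-- **The PRINTED product line (R3) (constant `2^{12d}`) from the recalled (R0) and Theorem 5.3 (i)** —
`rmk533Product_of_thm53i` with (R1) discharged: if (R0) `rad_L(λ,1−λ,−1) ≤ N(𝔣_{E_λ})` holds at `(L, λ)` and
Theorem 5.3 (i) holds at `(L, (λ,1−λ,−1), ε)`, then `Rmk533Product L λ ε`. CONDITIONAL on (R0) (FALSE in general —
`not_rmk533RadLeConductor_nineSixteenths` — but TRUE under the proviso of `…ConductorFormRadicalBoundProofs` §4) and
on `Thm53i`; no side taken. [cite: MochizukiEtAl2022, Rmk 5.3.3 p. 222 l. 39–47] -/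
theorem rmk533Product_of_thm53i' {lam : L} {ε : ℝ} (hR0 : Rmk533RadLeConductor lam)
    (h53 : Thm53i L lam (1 - lam) (-1) ε) : Rmk533Product L lam ε := by
  intro hL h0 h1 hε hε1
  exact rmk533Product_of_thm53i (rmk533LocalBound_of_ne h0 h1) hR0 h53 hL h0 h1 hε hε1

/-- **The PRINTED product line (R3), with the printed constant `2^{12d}`, from Theorem 5.3 (i) under the proviso
missing in print**: if `E_λ` (`λ ≠ 0, 1`) has bad reduction at every place `v ∣ 2` of `L` lying in
`I_L(λ,1−λ,−1)` — so that the recalled (R0) holds (`rmk533RadLeConductor_of_not_hasGoodReductionAt_above_two`) —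
then Theorem 5.3 (i) at `(L, (λ,1−λ,−1), ε)` implies `Rmk533Product L λ ε` exactly as printed. CONDITIONAL on
`Thm53i` only; the proviso is NOT-IN-PRINT; no side taken. [cite: MochizukiEtAl2022, Rmk 5.3.3 p. 222 l. 39–47] -/
theorem rmk533Product_of_thm53i_of_not_hasGoodReductionAt_above_two {lam : L} {ε : ℝ} (h0 : lam ≠ 0)
    (h1 : lam ≠ 1)
    (h2 : ∀ v : HeightOneSpectrum (𝓞 L), (2 : 𝓞 L) ∈ v.asIdeal → v ∈ badPrimes lam (1 - lam) (-1) →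
      ¬ (⟨0, -(1 + lam), 0, lam, 0⟩ : WeierstrassCurve L).HasGoodReductionAt v)
    (h53 : Thm53i L lam (1 - lam) (-1) ε) : Rmk533Product L lam ε :=
  rmk533Product_of_thm53i' (rmk533RadLeConductor_of_not_hasGoodReductionAt_above_two h0 h1 h2) h53

/-- **The PRINTED first line (R2) (`max` form) when `rad_L(λ,1−λ,−1) = N(𝔣_{E_λ})`** — `rmk533_of_thm53i_of_rad_eq`
with (R1) discharged. CONDITIONAL on `Thm53i`; no side taken. [cite: MochizukiEtAl2022, Rmk 5.3.3 p. 222 l. 42–45] -/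
theorem rmk533_of_thm53i_of_rad_eq' {lam : L} {ε : ℝ}
    (hrad : (radL lam (1 - lam) (-1) : ℝ) = (legendreCondNorm lam : ℝ))
    (h53 : Thm53i L lam (1 - lam) (-1) ε) : Rmk533 L lam ε := by
  intro hL h0 h1 hε hε1
  exact rmk533_of_thm53i_of_rad_eq (rmk533LocalBound_of_ne h0 h1) hrad h53 hL h0 h1 hε hε1

end ExpEst

end Literature.IUT.LogVolume
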